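import Summits.BirchSwinnertonDyer.Rank1Residual.X11b.Three.CornerResidual
import Summits.BirchSwinnertonDyer.BirchSwinnertonDyer.Theorems.ClassRecordThreeCornerAtThreeBranchesDefs
import HarnessLib

/-!
# Route `ClassRecordThree` (rung K2@3), crux 7 `CornerAtThree` (item stmt-BirchSwinnertonDyer-19111, shared with
# `KolyvaginRoadThree`), registered stub `stub_cornerUpper3` = `∀ W, Three.CornerUpperAt W` — the CO-CHAIN road:
# the Tamagawa-SHARP Kolyvagin bound over `K` on the `¬Surj` corner at `3` from the Λ-adic Kolyvagin-SYSTEM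
# divisibility at `𝟙` and the anticyclotomic CONTROL identity (cell `bsd-stepL`, width-lever second lane
# `bsd-stepL-corner3-p2`; `--supports stmt-BirchSwinnertonDyer-19111`)

HONEST FRAMING: theorems only (no definition, no named fact, no `sorry`); CONDITIONAL reductions; nothing is
asserted about any curve; item 19111 stays open; BSD is not advanced; no census word, tier or label moves (T7).

## The road (director-bsd WIDTH-LEVER 2026-08-27: «Kolyvagin-system bound at p = 3 (Heegner index + Tamagawa
## control) instead of the IMC-corner divisibility road»)

Conjunct 3 of the crux, `Three.CornerUpperAt W` (`X11b/Three/CornerResidual.lean`), is the Tamagawa-SHARP bound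
`ord₃ #Ш(E/K) + 2·ord₃ ∏_ℓ c_ℓ(E) ≤ 2·ord₃ [E(K):ℤP]` at every odd-`d_K` Manin-good Heegner datum of a corner pair
(`ClassX11b W 3 ∧ ¬ Surj W 3`, `3 ∣ ∏_ℓ c_ℓ(E)`), `P` the Heegner point, `Ш(E/K)` finite. Lane A (`bsd-stepL-corner-p1`)
attacks it along the CLASSICAL Kolyvagin road (Cha 2005 Rmk. 25 structure half + Jetchev's global `3^s`-divisibility
of the derived Heegner points, prime swap à la McCallum Prop. 5.2 / BCGS). THIS file records the Λ-ADIC road — the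
co-chain of route p2's STEP L — in which the Tamagawa term is supplied EXACTLY by the control theorem:

* (U1) **co-IMC ∘ BDP at `𝟙`** — the Kolyvagin-SYSTEM (Howard 2004 / Perrin-Riou Heegner-point main conjecture
  «⊆») direction of the anticyclotomic main conjecture for Castella's Selmer group, `f_ac ∣ L_𝔭^{BDP}(f)·u`, read at
  the trivial character through Castella 2018 Thm. 3.2 (`L_𝔭^{BDP}(f)(𝟙) = (1 − a_p p⁻¹)²·log_ω(P)²` up to a unit at
  `p ∣ N`): `ord_p f_ac(0) ≤ 2·(ord_p log_ω P − 1)` for the generator `f_ac` of `Ch_Λ(X_ac)` of the CONSTRUCTED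
  `X_ac = AcSelmer.XAc (E_K) p κ 𝔭 ∅ γ`. It is the TWIN of route p2's `IMCLowerWaldspurgerOnTreeAt`
  (`2·(ord_p log_ω P − 1) ≤ ord_p f_ac(0)`) and is stated INLINE below (no new predicate is declared in a proof
  file). OPEN at `p = 3` on the corner: every printed Kolyvagin-system divisibility (Howard 2004 Thm. B, BCK21,
  Sweeting, Castella–Wan) asks an image of `ρ_{E,p}` containing `SL₂(ℤ_p)` or at least `p ≥ 5`.
* (U2) **the anticyclotomic CONTROL identity** `X11b.ControlOnTreeAt p κ 𝔭 γ ι P` (Cas18 Thm. 2.3 / JSW17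
  Thm. 3.3.1 shape, `X11b/AnticyclotomicLogLinks.lean`): `ord_p f_ac(0) = ord_p #Ш(E/K)[p^∞] +
  2((ord_p log_ω P − 1) − ord_p [E(K):ℤP]) + ord_p ∏_{w∣N⁺} c_w(E/K)` — THIS is where the whole Tamagawa term enters
  («Tamagawa control»); at a Heegner field `ord_p ∏_{w∣N⁺} c_w(E/K) = ord_p ∏_w c_w(E/K) = 2·ord_p ∏_ℓ c_ℓ(E)`
  (tree theorems `padicValNat_tamagawaProductSplit_eq_of_heegner_prime`,
  `padicValNat_tamagawaProduct_baseChange_of_heegner_prime`).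

(U1) + (U2) ⟹ `ord_p #Ш(E/K)[p^∞] + ord_p ∏_{w∣N⁺} c_w ≤ 2·ord_p [E(K):ℤP]` by arithmetic (the two `f_ac`-valuations
agree by `XAc.HasCharValuationAt.unique`) — the exact twin of multr1-p2's `two_mul_index_le_of_onTreeUpperLinks`.

## Contents

* §1 (any `p`, any datum) `sha_add_tamagawaSplit_le_of_coLink_of_controlLower` — (U1) ∧ the `≥`-HALF of control
  (stated inline; all the road consumes) ⟹ the `K`-level inequality with `∏_{w∣N⁺} c_w`;
  `sha_add_tamagawaSplit_le_of_coLinks` — the same from (U1) ∧ (U2) (`controlLower_of_controlOnTreeAt`).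
* §2 (any `p`, Heegner field, `Ш(E/K)` finite) `shaOrder_add_two_mul_tamagawa_le_of_coLinks` — the SHARP shape
  `ord_p #Ш(E/K) + 2·ord_p ∏_ℓ c_ℓ(E) ≤ 2·ord_p [E(K):ℤP]`.
* §3 (class level, `p = 3`) **`Three.cornerUpperAt_of_coIMC_of_control`** — `Three.CornerUpperAt W` from the two
  inputs quantified over the corner frames EXACTLY as in `Three.CornerStepLAt` (with `3 ∣ ∏_ℓ c_ℓ(E)` added, as in
  `CornerUpperAt`): NO published fact is consumed (the finiteness of `Ш(E/K)` and `P ∉ E(K)_tors` are binders of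
  `CornerUpperAt`; `(κ, γ, 𝔭)` exist by `exists_anticyclotomic_generator_prime`, `𝔭` has degree one because
  `3 ∣ N` splits in a Heegner field); and `Three.cornerAtThreeUpper_of_coIMC_of_control` — the registered stub's
  statement `∀ W, Three.CornerUpperAt W` from the two inputs `∀ W`, and `Three.cornerAtThreeUpper_of_coIMC_of_control`
  — the same concluding the stub's constant `Theorems.CornerAtThreeUpper` (p488767) BY NAME.

What this is NOT: (U1) is untouched (typed inline, OPEN); (U2) on the corner (`¬Ram`, `3 ∣ c₃` on the 129 split
pairs, possibly `E(ℚ₃)[3] ≠ 0`) is NOT discharged here — in the tree it is a theorem on (ram) ∧ `3 ∤ ∏c` pairs only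
(`Three/ControlIdentityLocus.lean`); its corner discharge from the torsion-robust atoms
(`Theorems/EisensteinPrimesBSDpOnCellCCtlLocOfFinV.lean` pattern) is this lane's next file.

References: [Castella2018] Thm. 2.3 (arXiv:1704.06608 p. 5), Thm. 3.2 (p. 9), §5 (5.1)–(5.2) (p. 12);
[JetchevSkinnerWan2017] Thm. 3.3.1, §7.3.1 (eq:tamK), §7.4.2 (eq:shaupper) (arXiv:1512.06894 pp. 11, 30–31);
[Howard2004] B. Howard, *The Heegner point Kolyvagin system*, Compos. Math. 140 (2004), Thm. B (shape of (U1));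
[BurungaleCastellaKim2021] Thm. A / §5 (Howard's divisibility ⟺ the «⊆» half of the BDP main conjecture);
[GrossLMS1991] §2 Conj. (2.2); tree `X11b/Three/CornerResidual.lean`, `X11b/BDPRouteControlUpper.lean`.
-/

noncomputable section

open scoped Classical

open WeierstrassCurve NumberField IsDedekindDomain Field Literature.NumberTheory.EllipticCurves
  Literature.NumberTheory.EllipticCurves.ModularForms
  Literature.NumberTheory.EllipticCurves.Rank1Residual
  Literature.NumberTheory.EllipticCurves.Rank1Residual.Typed
  Literature.NumberTheory.QuadraticFields.Quadratic
  Summit.BirchSwinnertonDyer.Rank1Residual.X11b.AcSelmer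

namespace Summit.BirchSwinnertonDyer.Rank1Residual.X11b

/-! ### §1. The co-links at a datum: (U1) ∧ (U2) ⟹ `ord_p #Ш[p^∞] + ord_p ∏_{w∣N⁺} c_w ≤ 2·ord_p [E(K):ℤP]` -/

section Links

variable {W : WeierstrassCurve ℚ} [W.IsElliptic] [W.IsGloballyMinimal] {K : Type} [Field K]
  [NumberField K]
variable {p : ℕ} [Fact p.Prime] {κ : ZpExtension K p} {𝔭 : HeightOneSpectrum (𝓞 K)}
  {γ : Field.absoluteGaloisGroup K} [Fact (κ.IsTopGenerator γ)] {ι : K →+* ℚ_[p]}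

/-- The control identity implies its `≥`-half (bookkeeping, for consumers that hold `ControlOnTreeAt`). [folklore] -/
theorem controlLower_of_controlOnTreeAt {P : (W.baseChange K).toAffine.Point}
    (hCTL : ControlOnTreeAt p κ 𝔭 γ ι P) :
    ∃ n : ℕ, XAc.HasCharValuationAt (W.baseChange K) p κ 𝔭 ∅ γ n ∧
      (padicValNat p (Nat.card (AddCommGroup.primaryComponent (W.baseChange K).sha p)) : ℤ) +
        2 * ((padicLogOrd W p ι P - 1) - (padicValNat p (AddSubgroup.zmultiples P).index : ℤ)) +
          padicValNat p (tamagawaProductSplit W K) ≤ (n : ℤ) := by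
  obtain ⟨n, hn, heq⟩ := hCTL
  exact ⟨n, hn, le_of_eq heq.symm⟩

/-- **The same from the `≥`-HALF of control only** (all the co-chain consumes): if `ord_p f_ac(0) ≤
2(ord_p log_ω P − 1)` and `ord_p #Ш(E/K)[p^∞] + 2((ord_p log_ω P − 1) − ord_p [E(K):ℤP]) + ord_p ∏_{w∣N⁺} c_w ≤
ord_p f_ac(0)` for (the) generator of `Ch_Λ(X_ac)`, then `ord_p #Ш(E/K)[p^∞] + ord_p ∏_{w∣N⁺} c_w ≤
2·ord_p [E(K):ℤP]`. In Greenberg's proof of control this half is «`#Sel(K_∞)^Γ ≥ #Sel(K)·∏_v #ker r_v`»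
(surjectivity of the localisation + exact local kernel orders), the half route p2 does NOT use.
[cite: JetchevSkinnerWan2017, Thm. 3.3.1 and Prop. 3.3.4 (arXiv:1512.06894 pp. 11–13)]
[cite: GreenbergLNM1716, §3 (pp. 85–90)] -/
theorem sha_add_tamagawaSplit_le_of_coLink_of_controlLower {P : (W.baseChange K).toAffine.Point}
    (hco : ∃ n : ℕ, XAc.HasCharValuationAt (W.baseChange K) p κ 𝔭 ∅ γ n ∧
      (n : ℤ) ≤ 2 * (padicLogOrd W p ι P - 1))
    (hCTL : ∃ n : ℕ, XAc.HasCharValuationAt (W.baseChange K) p κ 𝔭 ∅ γ n ∧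
      (padicValNat p (Nat.card (AddCommGroup.primaryComponent (W.baseChange K).sha p)) : ℤ) +
        2 * ((padicLogOrd W p ι P - 1) - (padicValNat p (AddSubgroup.zmultiples P).index : ℤ)) +
          padicValNat p (tamagawaProductSplit W K) ≤ (n : ℤ)) :
    (padicValNat p (Nat.card (AddCommGroup.primaryComponent (W.baseChange K).sha p)) : ℤ) +
        padicValNat p (tamagawaProductSplit W K) ≤
      2 * (padicValNat p (AddSubgroup.zmultiples P).index : ℤ) := by
  obtain ⟨n, hn, hle⟩ := hco
  obtain ⟨n', hn', hge⟩ := hCTL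
  obtain rfl : n = n' := hn.unique hn'
  omega

/-- **(U1) co-IMC∘BDP at `𝟙` ∧ (U2) the control identity ⟹ `ord_p #Ш(E/K)[p^∞] + ord_p ∏_{w∣N⁺} c_w(E/K) ≤
2·ord_p [E(K):ℤP]`** — the UPPER twin of route p2's `two_mul_index_le_of_onTreeUpperLinks`: the Kolyvagin-system
direction `ord_p f_ac(0) ≤ 2(ord_p log_ω P − 1)` (stated inline on the constructed `X_ac`) and
`ControlOnTreeAt` (Cas18 Thm. 2.3 shape) at the same `(κ, γ, 𝔭, ι)`; the two generators' valuations agree by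
`XAc.HasCharValuationAt.unique`, the rest is arithmetic. CONDITIONAL on both links.
[cite: Castella2018, Thm. 2.3 (arXiv:1704.06608 p. 5) and §5 (5.1)–(5.2) (p. 12)]
[cite: JetchevSkinnerWan2017, §7.4.2 (eq:shaupper) (arXiv:1512.06894 p. 31)] -/
theorem sha_add_tamagawaSplit_le_of_coLinks {P : (W.baseChange K).toAffine.Point}
    (hco : ∃ n : ℕ, XAc.HasCharValuationAt (W.baseChange K) p κ 𝔭 ∅ γ n ∧
      (n : ℤ) ≤ 2 * (padicLogOrd W p ι P - 1))
    (hCTL : ControlOnTreeAt p κ 𝔭 γ ι P) :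
    (padicValNat p (Nat.card (AddCommGroup.primaryComponent (W.baseChange K).sha p)) : ℤ) +
        padicValNat p (tamagawaProductSplit W K) ≤
      2 * (padicValNat p (AddSubgroup.zmultiples P).index : ℤ) :=
  sha_add_tamagawaSplit_le_of_coLink_of_controlLower hco (controlLower_of_controlOnTreeAt hCTL)

/-! ### §2. At a Heegner field with `Ш(E/K)` finite: the SHARP shape `ord_p #Ш(E/K) + 2·ord_p ∏_ℓ c_ℓ(E) ≤ 2·ord_p [E(K):ℤP]` -/

/-- **The Tamagawa-SHARP `K`-bound from the co-links at a classical Heegner field**, any prime `p`: for `K`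
imaginary quadratic with the Heegner hypothesis for `N = N_E` (so `∏_{w∣N⁺} c_w = ∏_w c_w(E/K)` and
`ord_p ∏_w c_w(E/K) = 2·ord_p ∏_ℓ c_ℓ(E)`, tree theorems) and `Ш(E/K)` finite (`ord_p #Ш(E/K)[p^∞] = ord_p #Ш(E/K)`):
(U1) ∧ (U2) ⟹ `ord_p #Ш(E/K) + 2·ord_p ∏_ℓ c_ℓ(E) ≤ 2·ord_p [E(K):ℤP]` — Gross's Conj. (2.2) «≤» in Heegner-index
form, JSW17 (eq:shaupper). CONDITIONAL on both links. [cite: JetchevSkinnerWan2017, §7.3.1 (eq:tamK) and §7.4.2 (eq:shaupper) (arXiv:1512.06894 pp. 30–31)]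
[cite: GrossLMS1991, §2 Conj. (2.2) (shape)] -/
theorem shaOrder_add_two_mul_tamagawa_le_of_coLinks (hK : IsImaginaryQuadratic K)
    {N : ℕ} (hN : W.conductorNorm ℤ = N) (hH : SatisfiesHeegnerHypothesis N K)
    {P : (W.baseChange K).toAffine.Point} [Finite (W.baseChange K).sha]
    (hco : ∃ n : ℕ, XAc.HasCharValuationAt (W.baseChange K) p κ 𝔭 ∅ γ n ∧
      (n : ℤ) ≤ 2 * (padicLogOrd W p ι P - 1))
    (hCTL : ControlOnTreeAt p κ 𝔭 γ ι P) :
    padicValNat p (W.baseChange K).shaOrder + 2 * padicValNat p W.tamagawaProduct ≤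
      2 * padicValNat p (AddSubgroup.zmultiples P).index := by
  haveI : Finite (AddCommGroup.primaryComponent (W.baseChange K).sha p) :=
    Finite.of_injective _ Subtype.val_injective
  have h := sha_add_tamagawaSplit_le_of_coLinks hco hCTL
  rw [padicValNat_tamagawaProductSplit_eq_of_heegner_prime W K p hN hH,
    padicValNat_tamagawaProduct_baseChange_of_heegner_prime W K p hK hN hH,
    padicValNat_card_addPrimaryComponent] at h
  rw [WeierstrassCurve.shaOrder]
  omega

end Links

/-! ### §3. Class level at `p = 3`: `Three.CornerUpperAt W` from the two inputs on the corner frames -/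

namespace Three

variable (W : WeierstrassCurve ℚ) [W.IsElliptic] [W.IsGloballyMinimal]

/-- **`Three.CornerUpperAt W` FROM THE CO-CHAIN** — the Tamagawa-sharp Kolyvagin bound over `K` on the (T4″)@3
corner (`ClassX11b W 3 ∧ ¬ Surj W 3`, `3 ∣ ∏_ℓ c_ℓ(E)`) from two inputs quantified over exactly the corner frames of
`Three.CornerUpperAt` / `Three.CornerStepLAt` (every odd-`d_K` Manin-good Heegner datum with `L(E^{d_K},1) ≠ 0`, `P` the
Heegner point of infinite order; every anticyclotomic `κ`, topological generator `γ`, degree-one `𝔭 ∋ 3`, with THE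
embedding `embAt K 3 𝔭`): (U1) `hco` the Kolyvagin-SYSTEM direction at `𝟙`, `ord₃ f_ac(0) ≤ 2(ord₃ log_ω P − 1)` on
the constructed `X_ac` (OPEN — Howard's divisibility at `p = 3` for an image in the normaliser of a Cartan); (U2)
`hctl` the control identity `ControlOnTreeAt 3 κ 𝔭 γ embAt P` (Cas18 Thm. 2.3 shape; the Tamagawa term). NO
published fact is consumed: `Ш(E/K)` finite and `P ∉ E(K)_tors` are binders of `CornerUpperAt`; `(κ, γ, 𝔭)` exist by
`exists_anticyclotomic_generator_prime`; `𝔭` has degree one since `3 ∣ N_E` splits in the Heegner field. CONDITIONAL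
on the two inputs; nothing booked; item 19111 stays open. [cite: JetchevSkinnerWan2017, §7.4.2 (eq:shaupper) (arXiv:1512.06894 p. 31)]
[cite: Castella2018, Thm. 2.3 (p. 5), Thm. 3.2 (p. 9) (shapes)] [cite: GrossLMS1991, §2 Conj. (2.2) (shape)] -/
theorem cornerUpperAt_of_coIMC_of_control [Fact (Nat.Prime 3)]
    (hco : ∀ (N : ℕ) [NeZero N] (K : Type) [Field K] [NumberField K]
      (Dt : ModularParametrizationData W N) (H : HeegnerDatum N (NumberField.discr K)) (ι : K →+* ℂ)
      (P : (W.baseChange K).toAffine.Point),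
      ClassX11b W 3 → ¬ Surj W 3 → 3 ∣ W.tamagawaProduct → W.conductorNorm ℤ = N →
      IsImaginaryQuadratic K → Odd (NumberField.discr K) → SatisfiesHeegnerHypothesis N K →
      (W.quadraticTwist (NumberField.discr K : ℚ)).entireLFunction 1 ≠ 0 →
      WeierstrassCurve.Affine.Point.map ι.toRatAlgHom P = heegnerPointComplex Dt H →
      ¬ (3 : ℤ) ∣ Dt.c → ¬ IsOfFinAddOrder P →
      ∀ (κ : ZpExtension K 3), κ.IsAnticyclotomic →
        ∀ (γ : Field.absoluteGaloisGroup K) [Fact (κ.IsTopGenerator γ)]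
          (𝔭 : HeightOneSpectrum (𝓞 K)) (h𝔭 : ((3 : ℕ) : 𝓞 K) ∈ 𝔭.asIdeal)
          (he : 𝔭.asIdeal.ramificationIdx (𝓞 ℚ) = 1) (hf : 𝔭.asIdeal.inertiaDeg (𝓞 ℚ) = 1),
          ∃ n : ℕ, XAc.HasCharValuationAt (W.baseChange K) 3 κ 𝔭 ∅ γ n ∧
            (n : ℤ) ≤ 2 * (padicLogOrd W 3 (embAt K 3 𝔭 h𝔭 he hf) P - 1))
    (hctl : ∀ (N : ℕ) [NeZero N] (K : Type) [Field K] [NumberField K]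
      (Dt : ModularParametrizationData W N) (H : HeegnerDatum N (NumberField.discr K)) (ι : K →+* ℂ)
      (P : (W.baseChange K).toAffine.Point),
      ClassX11b W 3 → ¬ Surj W 3 → 3 ∣ W.tamagawaProduct → W.conductorNorm ℤ = N →
      IsImaginaryQuadratic K → Odd (NumberField.discr K) → SatisfiesHeegnerHypothesis N K →
      (W.quadraticTwist (NumberField.discr K : ℚ)).entireLFunction 1 ≠ 0 →
      WeierstrassCurve.Affine.Point.map ι.toRatAlgHom P = heegnerPointComplex Dt H →
      ¬ (3 : ℤ) ∣ Dt.c → ¬ IsOfFinAddOrder P →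
      ∀ (κ : ZpExtension K 3), κ.IsAnticyclotomic →
        ∀ (γ : Field.absoluteGaloisGroup K) [Fact (κ.IsTopGenerator γ)]
          (𝔭 : HeightOneSpectrum (𝓞 K)) (h𝔭 : ((3 : ℕ) : 𝓞 K) ∈ 𝔭.asIdeal)
          (he : 𝔭.asIdeal.ramificationIdx (𝓞 ℚ) = 1) (hf : 𝔭.asIdeal.inertiaDeg (𝓞 ℚ) = 1),
          ControlOnTreeAt 3 κ 𝔭 γ (embAt K 3 𝔭 h𝔭 he hf) P) :
    CornerUpperAt W := by
  intro N _ K _ _ Dt H ι P hX hns ht hN hK hodd hHN hLt hP hc hPinf hfin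
  obtain ⟨-, -, hmult, -⟩ := id hX
  have hpN : 3 ∣ N := hN ▸ dvd_conductorNorm_of_mult hmult
  have hsplit : SplitsIn K 3 := hHN 3 Fact.out hpN
  obtain ⟨κ, γ, 𝔭, hκ, hγ, h𝔭⟩ := exists_anticyclotomic_generator_prime (p := 3) hK
  haveI : Fact (κ.IsTopGenerator γ) := ⟨hγ⟩
  obtain ⟨he, hf⟩ := degreeOne_of_splitsIn hK.1 hsplit h𝔭
  exact shaOrder_add_two_mul_tamagawa_le_of_coLinks hK hN hHN
    (hco N K Dt H ι P hX hns ht hN hK hodd hHN hLt hP hc hPinf κ hκ γ 𝔭 h𝔭 he hf)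
    (hctl N K Dt H ι P hX hns ht hN hK hodd hHN hLt hP hc hPinf κ hκ γ 𝔭 h𝔭 he hf)

/-- **The registered stub's statement `∀ W, Three.CornerUpperAt W` (= `Theorems.CornerAtThreeUpper`, stub
`stub_cornerUpper3` of the 19111 skeleton `Lines/birth.lean`) from the two co-chain inputs `∀ W`.** One line over
`cornerUpperAt_of_coIMC_of_control`. CONDITIONAL; closes nothing. [cite: JetchevSkinnerWan2017, §7.4.2 (eq:shaupper) (arXiv:1512.06894 p. 31)] -/
theorem forall_cornerUpperAt_of_coIMC_of_control [Fact (Nat.Prime 3)]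
    (hco : ∀ (W : WeierstrassCurve ℚ) [W.IsElliptic] [W.IsGloballyMinimal]
      (N : ℕ) [NeZero N] (K : Type) [Field K] [NumberField K]
      (Dt : ModularParametrizationData W N) (H : HeegnerDatum N (NumberField.discr K)) (ι : K →+* ℂ)
      (P : (W.baseChange K).toAffine.Point),
      ClassX11b W 3 → ¬ Surj W 3 → 3 ∣ W.tamagawaProduct → W.conductorNorm ℤ = N →
      IsImaginaryQuadratic K → Odd (NumberField.discr K) → SatisfiesHeegnerHypothesis N K →
      (W.quadraticTwist (NumberField.discr K : ℚ)).entireLFunction 1 ≠ 0 →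
      WeierstrassCurve.Affine.Point.map ι.toRatAlgHom P = heegnerPointComplex Dt H →
      ¬ (3 : ℤ) ∣ Dt.c → ¬ IsOfFinAddOrder P →
      ∀ (κ : ZpExtension K 3), κ.IsAnticyclotomic →
        ∀ (γ : Field.absoluteGaloisGroup K) [Fact (κ.IsTopGenerator γ)]
          (𝔭 : HeightOneSpectrum (𝓞 K)) (h𝔭 : ((3 : ℕ) : 𝓞 K) ∈ 𝔭.asIdeal)
          (he : 𝔭.asIdeal.ramificationIdx (𝓞 ℚ) = 1) (hf : 𝔭.asIdeal.inertiaDeg (𝓞 ℚ) = 1),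
          ∃ n : ℕ, XAc.HasCharValuationAt (W.baseChange K) 3 κ 𝔭 ∅ γ n ∧
            (n : ℤ) ≤ 2 * (padicLogOrd W 3 (embAt K 3 𝔭 h𝔭 he hf) P - 1))
    (hctl : ∀ (W : WeierstrassCurve ℚ) [W.IsElliptic] [W.IsGloballyMinimal]
      (N : ℕ) [NeZero N] (K : Type) [Field K] [NumberField K]
      (Dt : ModularParametrizationData W N) (H : HeegnerDatum N (NumberField.discr K)) (ι : K →+* ℂ)
      (P : (W.baseChange K).toAffine.Point),
      ClassX11b W 3 → ¬ Surj W 3 → 3 ∣ W.tamagawaProduct → W.conductorNorm ℤ = N →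
      IsImaginaryQuadratic K → Odd (NumberField.discr K) → SatisfiesHeegnerHypothesis N K →
      (W.quadraticTwist (NumberField.discr K : ℚ)).entireLFunction 1 ≠ 0 →
      WeierstrassCurve.Affine.Point.map ι.toRatAlgHom P = heegnerPointComplex Dt H →
      ¬ (3 : ℤ) ∣ Dt.c → ¬ IsOfFinAddOrder P →
      ∀ (κ : ZpExtension K 3), κ.IsAnticyclotomic →
        ∀ (γ : Field.absoluteGaloisGroup K) [Fact (κ.IsTopGenerator γ)]
          (𝔭 : HeightOneSpectrum (𝓞 K)) (h𝔭 : ((3 : ℕ) : 𝓞 K) ∈ 𝔭.asIdeal)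
          (he : 𝔭.asIdeal.ramificationIdx (𝓞 ℚ) = 1) (hf : 𝔭.asIdeal.inertiaDeg (𝓞 ℚ) = 1),
          ControlOnTreeAt 3 κ 𝔭 γ (embAt K 3 𝔭 h𝔭 he hf) P) :
    ∀ (W : WeierstrassCurve ℚ) [W.IsElliptic] [W.IsGloballyMinimal], CornerUpperAt W :=
  fun W _ _ ↦ cornerUpperAt_of_coIMC_of_control W (hco W) (hctl W)

/-- **The registered stub BY NAME: `Theorems.CornerAtThreeUpper` (p488767; = `∀ W, Three.CornerUpperAt W`, stub
`stub_cornerUpper3` of the 19111 skeleton) from the two co-chain inputs `∀ W`.** CONDITIONAL; closes nothing.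
[cite: JetchevSkinnerWan2017, §7.4.2 (eq:shaupper) (arXiv:1512.06894 p. 31)] -/
theorem cornerAtThreeUpper_of_coIMC_of_control [Fact (Nat.Prime 3)]
    (hco : ∀ (W : WeierstrassCurve ℚ) [W.IsElliptic] [W.IsGloballyMinimal]
      (N : ℕ) [NeZero N] (K : Type) [Field K] [NumberField K]
      (Dt : ModularParametrizationData W N) (H : HeegnerDatum N (NumberField.discr K)) (ι : K →+* ℂ)
      (P : (W.baseChange K).toAffine.Point),
      ClassX11b W 3 → ¬ Surj W 3 → 3 ∣ W.tamagawaProduct → W.conductorNorm ℤ = N →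
      IsImaginaryQuadratic K → Odd (NumberField.discr K) → SatisfiesHeegnerHypothesis N K →
      (W.quadraticTwist (NumberField.discr K : ℚ)).entireLFunction 1 ≠ 0 →
      WeierstrassCurve.Affine.Point.map ι.toRatAlgHom P = heegnerPointComplex Dt H →
      ¬ (3 : ℤ) ∣ Dt.c → ¬ IsOfFinAddOrder P →
      ∀ (κ : ZpExtension K 3), κ.IsAnticyclotomic →
        ∀ (γ : Field.absoluteGaloisGroup K) [Fact (κ.IsTopGenerator γ)]
          (𝔭 : HeightOneSpectrum (𝓞 K)) (h𝔭 : ((3 : ℕ) : 𝓞 K) ∈ 𝔭.asIdeal)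
          (he : 𝔭.asIdeal.ramificationIdx (𝓞 ℚ) = 1) (hf : 𝔭.asIdeal.inertiaDeg (𝓞 ℚ) = 1),
          ∃ n : ℕ, XAc.HasCharValuationAt (W.baseChange K) 3 κ 𝔭 ∅ γ n ∧
            (n : ℤ) ≤ 2 * (padicLogOrd W 3 (embAt K 3 𝔭 h𝔭 he hf) P - 1))
    (hctl : ∀ (W : WeierstrassCurve ℚ) [W.IsElliptic] [W.IsGloballyMinimal]
      (N : ℕ) [NeZero N] (K : Type) [Field K] [NumberField K]
      (Dt : ModularParametrizationData W N) (H : HeegnerDatum N (NumberField.discr K)) (ι : K →+* ℂ)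
      (P : (W.baseChange K).toAffine.Point),
      ClassX11b W 3 → ¬ Surj W 3 → 3 ∣ W.tamagawaProduct → W.conductorNorm ℤ = N →
      IsImaginaryQuadratic K → Odd (NumberField.discr K) → SatisfiesHeegnerHypothesis N K →
      (W.quadraticTwist (NumberField.discr K : ℚ)).entireLFunction 1 ≠ 0 →
      WeierstrassCurve.Affine.Point.map ι.toRatAlgHom P = heegnerPointComplex Dt H →
      ¬ (3 : ℤ) ∣ Dt.c → ¬ IsOfFinAddOrder P →
      ∀ (κ : ZpExtension K 3), κ.IsAnticyclotomic →
        ∀ (γ : Field.absoluteGaloisGroup K) [Fact (κ.IsTopGenerator γ)]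
          (𝔭 : HeightOneSpectrum (𝓞 K)) (h𝔭 : ((3 : ℕ) : 𝓞 K) ∈ 𝔭.asIdeal)
          (he : 𝔭.asIdeal.ramificationIdx (𝓞 ℚ) = 1) (hf : 𝔭.asIdeal.inertiaDeg (𝓞 ℚ) = 1),
          ControlOnTreeAt 3 κ 𝔭 γ (embAt K 3 𝔭 h𝔭 he hf) P) :
    Summit.BirchSwinnertonDyer.BirchSwinnertonDyer.Theorems.CornerAtThreeUpper :=
  forall_cornerUpperAt_of_coIMC_of_control hco hctl

end Three

end Summit.BirchSwinnertonDyer.Rank1Residual.X11b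

end
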